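import Literature.NumberTheory.LFunctions.ZetaZeroSumsPsiWeightMiddle
import HarnessLib

/-!
# RH-FREE — Fiori–Kadiri–Swidinsky 2023, Proposition 3.11 and Corollary 3.12: the high part `Σ_{σ₂}^1 = 2Σ_{0<γ<T, σ₂≤β<1} x^{β−1}/γ ≤ ε₄(x,σ₂,K,T)` of the zero sum for `ψ` («nothing here bears on the truth of RH»)

Topic `Literature/NumberTheory/LFunctions` (RH literature-typing tranche 1, L4 "explicit zero
statistics", gen 5). Label **RH-FREE**. Four definitions (the printed weight `x^{−1/(R log t)}/t`,
`t₀(σ₂,x)`, the geometric heights `t_k`, and `ε₄`) and THEOREMS; no named facts. Nothing here bears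
on the truth of RH.

Fiori–Kadiri–Swidinsky, J. Math. Anal. Appl. 527 (2023) 127426 = arXiv:2204.02588v3 (item and
equation numbers below are those of arXiv v3, whose theorem-like environments share one counter),
§3.5 "Bounds for `Σ_{σ₂}^1`". By the zero-free region `σ ≥ 1 − 1/(R log|t|)` (`|t| ≥ 2`) and the
RH verification up to `H₀`, the zeros with `β ≥ σ₂ > ½` have `β ≤ 1 − 1/(R log γ)` and
`γ ≥ H_{σ₂}` (eq. (3.12), the tree's `FKS2023.zfrHeight`), whence (eq. (3.21))
`Σ_{σ₂}^1 ≤ 2 Σ_{H_{σ₂} ≤ γ < T, β ≥ σ₂} x^{−1/(R log γ)}/γ` (`x ≥ 1`).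

* **Proposition 3.11** (PROVED, `FioriKadiriSwidinsky2023_prop311` and `…_prop311_simple`): with
  `t₀ = t₀(σ₂,x) = max(H_{σ₂}, exp(√(log x / R)))` and `t₀ = t_0 < t_1 < … < t_K = T`,
  `Σ_{σ₂}^1 ≤ 2 N(σ₂,T) x^{−1/(R log t₀)}/t₀` and
  `Σ_{σ₂}^1 ≤ 2(Σ_{k=1}^{K−1} N(σ₂,t_k)(w(t_{k−1}) − w(t_k)) + w(t_{K−1}) N(σ₂,T))`,
  `w(t) = x^{−1/(R log t)}/t` (`FKS2023.zfrWeight`). The printed proof is a Riemann–Stieltjes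
  integration by parts using that `w` decreases for `t > exp(√(log x/R))`; here the same bound is
  obtained zero by zero: `w(γ) ≤ w(t_k)` for `γ ≥ t_k ≥ t₀` (`FKS2023.zfrWeight_le_of_t₀_le`) and
  `w(γ) ≤ w(t₀)` for every `γ ≥ H_{σ₂}` (`FKS2023.zfrWeight_le_weight_t₀`: `w` increases up to
  `exp(√(log x/R))` and decreases after), followed by Abel summation over the layers `γ ≤ t_k`
  (the printed "shifting the sum"). The hypotheses `K ≥ 2`, "strictly increasing", `T > t₀`,
  `σ₂ > 5/8` of the print are relaxed to `K ≥ 1`, monotone, any `T`, `σ₂ > ½`.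
* **Corollary 3.12** (PROVED, `FioriKadiriSwidinsky2023_cor312`): with `λ = (T/t₀)^{1/K}`,
  `t_k = t₀ λ^k` (`FKS2023.tStep`) and a (ZDB) majorant `N(σ₂,T') ≤ Ñ(σ₂,T') = c₁ T'^p (log T')^q
  + c₂ (log T')²` for `T' ≥ H₀` (`FKS2023.zdbMajorant`; e.g. Cor. 2.9),
  `Σ_{σ₂}^1 ≤ ε₄(x,σ₂,K,T) = 2 Σ_{k=1}^{K−1} w(t_k)(Ñ(σ₂,t_{k+1}) − Ñ(σ₂,t_k)) + 2 Ñ(σ₂,t₁) w(t₀)`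
  (eq. (3.22), `FKS2023.ε₄`), by `N ≤ Ñ` in the monotone form of Prop. 3.11 and the printed
  telescoping (`K ≥ 1`, `T ≥ t₀`).

## References

* A. Fiori, H. Kadiri, J. Swidinsky, J. Math. Anal. Appl. 527 (2023) 127426 (arXiv:2204.02588v3),
  §3.5 eqs. (3.21)–(3.23), Proposition 3.11, Corollary 3.12. [FioriKadiriSwidinsky2023]
* M. J. Mossinghoff, T. S. Trudgian, A. Yang, Res. Number Theory 10 (2024), Thm. 1 (a zero-free
  region of the required shape, `R = 5.558691`). [MossinghoffTrudgianYangRNT2024]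
-/

noncomputable section

open Complex Filter Set
open scoped Real

namespace Literature.NumberTheory.LFunctions

open SchoenfeldBound

namespace FKS2023

/-- The weight `w(t) = x^{−1/(R log t)}/t` of eq. (3.21) and Prop. 3.11.
[cite: FioriKadiriSwidinsky2023, §3.5 eq. (3.21)] -/
def zfrWeight (R x t : ℝ) : ℝ := x ^ (-(1 / (R * Real.log t))) / t

/-- `t₀ = t₀(σ₂, x) = max(H_{σ₂}, exp(√(log x / R)))` of Prop. 3.11.
[cite: FioriKadiriSwidinsky2023, Prop. 3.11] -/
def t₀ (R σ x : ℝ) : ℝ := max (zfrHeight R σ) (Real.exp (Real.sqrt (Real.log x / R)))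

/-- The geometric heights `t_k = t₀ λ^k`, `λ = (T/t₀)^{1/K}`, of Cor. 3.12.
[cite: FioriKadiriSwidinsky2023, Cor. 3.12] -/
def tStep (R σ x T : ℝ) (K k : ℕ) : ℝ := t₀ R σ x * ((T / t₀ R σ x) ^ (1 / (K : ℝ))) ^ k

/-- **`ε₄(x, σ₂, K, T)`** of eq. (3.22), for a (ZDB) majorant `Ñ = c₁ T^p (log T)^q + c₂ log² T` and
zero-free-region constant `R`:
`2 Σ_{k=1}^{K−1} w(t_k)(Ñ(t_{k+1}) − Ñ(t_k)) + 2 Ñ(t₁) w(t₀)`, `w(t) = x^{−1/(R log t)}/t`.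
[cite: FioriKadiriSwidinsky2023, Cor. 3.12 eq. (3.22)] -/
def ε₄ (c₁ c₂ p q R x σ₂ : ℝ) (K : ℕ) (T : ℝ) : ℝ :=
  2 * ∑ k ∈ Finset.Ico 1 K, zfrWeight R x (tStep R σ₂ x T K k) *
      (zdbMajorant c₁ c₂ p q (tStep R σ₂ x T K (k + 1)) - zdbMajorant c₁ c₂ p q (tStep R σ₂ x T K k))
    + 2 * zdbMajorant c₁ c₂ p q (tStep R σ₂ x T K 1) * zfrWeight R x (tStep R σ₂ x T K 0)

end FKS2023

/-! ## The weight `x^{−1/(R log t)}/t` -/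

/-- `w(t) = exp(−(log x)/(R log t) − log t)` (`x, t > 0`). [cite: FioriKadiriSwidinsky2023, §3.5 eq. (3.21)] -/
theorem FKS2023.zfrWeight_eq_exp {R x t : ℝ} (hx : 0 < x) (ht : 0 < t) :
    FKS2023.zfrWeight R x t = Real.exp (-(Real.log x / R / Real.log t + Real.log t)) := by
  unfold FKS2023.zfrWeight
  rw [Real.rpow_def_of_pos hx, neg_add', Real.exp_sub, Real.exp_log ht]
  congr 2
  ring

/-- `w(t) ≥ 0` for `x, t ≥ 0`. [cite: FioriKadiriSwidinsky2023, §3.5 eq. (3.21)] -/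
theorem FKS2023.zfrWeight_nonneg {R x t : ℝ} (hx : 0 ≤ x) (ht : 0 ≤ t) :
    0 ≤ FKS2023.zfrWeight R x t := by
  unfold FKS2023.zfrWeight
  exact div_nonneg (Real.rpow_nonneg hx _) ht

/-- **The weight peaks at `t = exp(√(log x/R))`**: `w(t) ≤ w(exp √(log x/R))` for `t > 1`, `x ≥ 1`
(AM–GM on the exponent `(log x)/(R log t) + log t`; the printed `d/dt w` changes sign there).
[cite: FioriKadiriSwidinsky2023, Prop. 3.11 (proof)] -/
theorem FKS2023.zfrWeight_le_peak {R x t : ℝ} (hR : 0 < R) (hx : 1 ≤ x) (ht : 1 < t) :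
    FKS2023.zfrWeight R x t ≤ FKS2023.zfrWeight R x (Real.exp (Real.sqrt (Real.log x / R))) := by
  have hx0 : 0 < x := by linarith
  have ht0 : 0 < t := by linarith
  rw [FKS2023.zfrWeight_eq_exp hx0 ht0, FKS2023.zfrWeight_eq_exp hx0 (Real.exp_pos _), Real.log_exp,
    Real.exp_le_exp, neg_le_neg_iff]
  set a := Real.log x / R with ha
  have ha0 : 0 ≤ a := div_nonneg (Real.log_nonneg hx) hR.le
  set s := Real.sqrt a with hs
  have hs0 : 0 ≤ s := Real.sqrt_nonneg a
  have hss : s * s = a := Real.mul_self_sqrt ha0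
  set u := Real.log t with hu
  have hu0 : 0 < u := Real.log_pos ht
  rcases eq_or_lt_of_le hs0 with h0 | hpos
  · have ha' : a = 0 := by rw [← hss, ← h0, mul_zero]
    rw [ha', ← h0, zero_div, zero_div, zero_add, zero_add]
    exact hu0.le
  · rw [div_add' _ _ _ hpos.ne', div_add' _ _ _ hu0.ne', div_le_div_iff₀ hpos hu0, ← hss]
    nlinarith [mul_nonneg hpos.le (sq_nonneg (u - s))]

/-- **The weight decreases after the peak**: for `exp(√(log x/R)) ≤ u ≤ v` (`x ≥ 1`), `w(v) ≤ w(u)`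
(the printed "`d/dt w` becomes negative as soon as `t > exp(√(log x/R))`").
[cite: FioriKadiriSwidinsky2023, Prop. 3.11 (proof)] -/
theorem FKS2023.zfrWeight_le_of_le {R x u v : ℝ} (hR : 0 < R) (hx : 1 ≤ x)
    (hu : Real.exp (Real.sqrt (Real.log x / R)) ≤ u) (huv : u ≤ v) :
    FKS2023.zfrWeight R x v ≤ FKS2023.zfrWeight R x u := by
  have hx0 : 0 < x := by linarith
  have hu0 : 0 < u := (Real.exp_pos _).trans_le hu
  have hv0 : 0 < v := hu0.trans_le huv
  rw [FKS2023.zfrWeight_eq_exp hx0 hv0, FKS2023.zfrWeight_eq_exp hx0 hu0, Real.exp_le_exp,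
    neg_le_neg_iff]
  set a := Real.log x / R with ha
  have ha0 : 0 ≤ a := div_nonneg (Real.log_nonneg hx) hR.le
  set s := Real.sqrt a with hs
  have hs0 : 0 ≤ s := Real.sqrt_nonneg a
  have hss : s * s = a := Real.mul_self_sqrt ha0
  have hsU : s ≤ Real.log u := by
    rw [← Real.log_exp s]; exact Real.log_le_log (Real.exp_pos _) hu
  have hUV : Real.log u ≤ Real.log v := Real.log_le_log hu0 huv
  set U := Real.log u with hU
  set V := Real.log v with hV
  have haUV : a ≤ U * V := by
    rw [← hss]; exact mul_le_mul hsU (hsU.trans hUV) hs0 (hs0.trans hsU)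
  rcases eq_or_lt_of_le (hs0.trans hsU) with hU0 | hUpos
  · have ha' : a = 0 := le_antisymm (by rw [← hU0, zero_mul] at haUV; exact haUV) ha0
    rw [ha', ← hU0, zero_div, zero_div, zero_add, zero_add]
    linarith
  · have hVpos : 0 < V := hUpos.trans_le hUV
    rw [div_add' _ _ _ hUpos.ne', div_add' _ _ _ hVpos.ne', div_le_div_iff₀ hUpos hVpos]
    nlinarith [mul_le_mul_of_nonneg_right haUV (sub_nonneg.2 hUV)]

/-- Past `t₀ ≥ exp(√(log x/R))` the weight decreases: `t₀(σ₂,x) ≤ u ≤ v ⟹ w(v) ≤ w(u)`.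
[cite: FioriKadiriSwidinsky2023, Prop. 3.11 (proof)] -/
theorem FKS2023.zfrWeight_le_of_t₀_le {R σ x u v : ℝ} (hR : 0 < R) (hx : 1 ≤ x)
    (hu : FKS2023.t₀ R σ x ≤ u) (huv : u ≤ v) :
    FKS2023.zfrWeight R x v ≤ FKS2023.zfrWeight R x u :=
  FKS2023.zfrWeight_le_of_le hR hx ((le_max_right _ _).trans hu) huv

/-- **Every zero height `γ ≥ H_{σ₂}` has weight at most `w(t₀)`** (`γ > 1`, `x ≥ 1`): if `γ ≥ t₀`
by the decrease past `t₀`, and if `γ < t₀` then `t₀ = exp(√(log x/R))` is the peak (this is the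
printed `−∫_{H_{σ₂}}^T N dw ≤ −N(σ₂,T) ∫_{t₀}^T dw`). [cite: FioriKadiriSwidinsky2023, Prop. 3.11 (proof)] -/
theorem FKS2023.zfrWeight_le_weight_t₀ {R σ x γ : ℝ} (hR : 0 < R) (hx : 1 ≤ x) (hγ : 1 < γ)
    (hH : FKS2023.zfrHeight R σ ≤ γ) :
    FKS2023.zfrWeight R x γ ≤ FKS2023.zfrWeight R x (FKS2023.t₀ R σ x) := by
  unfold FKS2023.t₀
  rcases le_total (FKS2023.zfrHeight R σ) (Real.exp (Real.sqrt (Real.log x / R))) with h | h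
  · rw [max_eq_right h]
    exact FKS2023.zfrWeight_le_peak hR hx hγ
  · rw [max_eq_left h]
    exact FKS2023.zfrWeight_le_of_le hR hx h hH

/-- **The zero-free region bounds the `ψ`-weight**: a zero `ρ = β + iγ` with `γ ≥ 2` has
`β ≤ 1 − 1/(R log γ)`, so `x^{β−1}/γ ≤ x^{−1/(R log γ)}/γ = w(γ)` for `x ≥ 1` (eq. (3.21)).
[cite: FioriKadiriSwidinsky2023, §3.5 eq. (3.21)] -/
theorem FKS2023.rpow_div_le_zfrWeight {R : ℝ} (hR : 0 < R)
    (hZFR : ∀ σ t : ℝ, 2 ≤ |t| → 1 - 1 / (R * Real.log |t|) ≤ σ → riemannZeta (σ + t * I) ≠ 0)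
    {x : ℝ} (hx : 1 ≤ x) {ρ : ℂ} (hz : riemannZeta ρ = 0) (him : 2 ≤ ρ.im) :
    x ^ (ρ.re - 1) / ρ.im ≤ FKS2023.zfrWeight R x ρ.im := by
  have _ := hR
  unfold FKS2023.zfrWeight
  have him0 : 0 < ρ.im := by linarith
  refine div_le_div_of_nonneg_right (Real.rpow_le_rpow_of_exponent_le hx ?_) him0.le
  by_contra hlt
  rw [not_le] at hlt
  have h := hZFR ρ.re ρ.im (by rwa [abs_of_pos him0]) (by rw [abs_of_pos him0]; linarith)
  exact h (by rw [Complex.re_add_im]; exact hz)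

/-- **The staircase in `t`**: for `γ ≥ H_{σ₂}`, `γ > 1`, heights `t₀(σ₂,x) = t_0 ≤ t_1 ≤ …` and
`K ≥ 1`, `w(γ) ≤ w(t_{K−1}) + Σ_{1≤k<K, γ≤t_k} (w(t_{k−1}) − w(t_k))` (`= w(t_{k*−1})` for the least
`k* ≥ 1` with `γ ≤ t_{k*}`; the printed "use `N(σ₂,t) ≤ N(σ₂,t_{k+1})` on each piece", rearranged).
[cite: FioriKadiriSwidinsky2023, Prop. 3.11 (proof)] -/
theorem FKS2023.zfrWeight_le_staircase {R σ x γ : ℝ} (hR : 0 < R) (hx : 1 ≤ x) (hγ : 1 < γ)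
    (hH : FKS2023.zfrHeight R σ ≤ γ) {t : ℕ → ℝ} (ht0 : t 0 = FKS2023.t₀ R σ x) (hmono : Monotone t)
    {K : ℕ} (hK : 1 ≤ K) :
    FKS2023.zfrWeight R x γ ≤ FKS2023.zfrWeight R x (t (K - 1)) +
      ∑ k ∈ Finset.Ico 1 K, (if γ ≤ t k then
        FKS2023.zfrWeight R x (t (k - 1)) - FKS2023.zfrWeight R x (t k) else 0) := by
  induction K, hK using Nat.le_induction with
  | base =>
    simp only [Nat.sub_self, Finset.Ico_self, Finset.sum_empty, add_zero, ht0]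
    exact FKS2023.zfrWeight_le_weight_t₀ hR hx hγ hH
  | succ K hK ih =>
    rw [Finset.sum_Ico_succ_top hK, Nat.add_sub_cancel]
    have htk : ∀ k, FKS2023.t₀ R σ x ≤ t k := fun k ↦ ht0 ▸ hmono (Nat.zero_le k)
    split_ifs with hle
    · linarith [ih]
    · rw [not_le] at hle
      have hsum : 0 ≤ ∑ k ∈ Finset.Ico 1 K, (if γ ≤ t k then
          FKS2023.zfrWeight R x (t (k - 1)) - FKS2023.zfrWeight R x (t k) else 0) := by
        refine Finset.sum_nonneg fun k _ ↦ ?_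
        split_ifs
        · exact sub_nonneg.2 (FKS2023.zfrWeight_le_of_t₀_le hR hx (htk (k - 1)) (hmono (Nat.sub_le k 1)))
        · exact le_rfl
      have hK' : FKS2023.zfrWeight R x γ ≤ FKS2023.zfrWeight R x (t K) :=
        FKS2023.zfrWeight_le_of_t₀_le hR hx (htk K) hle.le
      linarith

/-- Abel summation in the printed form ("shifting the sum … telescoping"): for `K ≥ 1`,
`Σ_{k=1}^{K−1} N_k (w_{k−1} − w_k) + w_{K−1} N_K = Σ_{k=1}^{K−1} w_k (N_{k+1} − N_k) + N_1 w_0`.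
[cite: FioriKadiriSwidinsky2023, Prop. 3.11 (proof, last display)] -/
theorem FKS2023.abel_shift (N w : ℕ → ℝ) {K : ℕ} (hK : 1 ≤ K) :
    ∑ k ∈ Finset.Ico 1 K, N k * (w (k - 1) - w k) + w (K - 1) * N K =
      ∑ k ∈ Finset.Ico 1 K, w k * (N (k + 1) - N k) + N 1 * w 0 := by
  induction K, hK using Nat.le_induction with
  | base => simp [mul_comm]
  | succ K hK ih =>
    rw [Finset.sum_Ico_succ_top hK, Finset.sum_Ico_succ_top hK, Nat.add_sub_cancel]
    linear_combination ih

/-- `Σ_{ρ ∈ S} m(ρ) ≤ N(σ, T)` for any finite set `S` of zeros in the box `σ ≤ β ≤ 1`, `0 < γ ≤ T`.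
[cite: Titchmarsh1986, §9.1] -/
theorem sum_zeroOrder_le_countRe {σ T : ℝ} {S : Finset ℂ}
    (hS : ∀ ρ ∈ S, riemannZeta ρ = 0 ∧ σ ≤ ρ.re ∧ ρ.re ≤ 1 ∧ 0 < ρ.im ∧ ρ.im ≤ T) :
    ∑ ρ ∈ S, (riemannZetaZeroOrder ρ : ℝ) ≤ zetaZeroCountRe σ T := by
  classical
  have hsub : S ⊆ (zetaZeroBox_finite σ T).toFinset := fun ρ hρ ↦
    (Set.Finite.mem_toFinset _).2 (hS ρ hρ)
  have e : (zetaZeroCountRe σ T : ℝ) =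
      ∑ ρ ∈ (zetaZeroBox_finite σ T).toFinset, (riemannZetaZeroOrder ρ : ℝ) := by
    have h := congrArg (Int.cast : ℤ → ℝ) (zetaZeroCountRe_eq_sum σ T)
    push_cast at h
    exact h
  rw [e]
  exact Finset.sum_le_sum_of_subset_of_nonneg hsub fun ρ hρ _ ↦
    Int.cast_nonneg (riemannZetaZeroOrder_nonneg_of_mem_zetaZeroBox ((Set.Finite.mem_toFinset _).1 hρ))

/-! ## Proposition 3.11 -/

/-- **FKS Proposition 3.11, first bound** (PROVED; any `T`): under the numerical-RH fact and a
zero-free region `σ ≥ 1 − 1/(R log|t|)` (`|t| ≥ 2`, `R > 0`), for `½ < σ₂ ≤ 1` and `x ≥ 1`,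
`Σ_{σ₂}^1(x,T) ≤ 2 N(σ₂,T) · x^{−1/(R log t₀)}/t₀`, `t₀ = max(H_{σ₂}, exp(√(log x/R)))`.
[cite: FioriKadiriSwidinsky2023, Prop. 3.11] -/
theorem FioriKadiriSwidinsky2023_prop311_simple (hRH : platt_trudgian_numerical_rh) {R : ℝ}
    (hR : 0 < R)
    (hZFR : ∀ σ t : ℝ, 2 ≤ |t| → 1 - 1 / (R * Real.log |t|) ≤ σ → riemannZeta (σ + t * I) ≠ 0)
    {σ₂ : ℝ} (hσ₂ : 1 / 2 < σ₂) {x : ℝ} (hx : 1 ≤ x) (T : ℝ) :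
    FKS2023.zeroSumPsi σ₂ 1 x T ≤
      2 * zetaZeroCountRe σ₂ T * FKS2023.zfrWeight R x (FKS2023.t₀ R σ₂ x) := by
  classical
  have hx0 : 0 < x := by linarith
  have hH₀ : FKS2023.H₀ = 3 * 10 ^ 12 := rfl
  unfold FKS2023.zeroSumPsi
  set S := (zerosBetween 0 T).filter (fun ρ ↦ σ₂ ≤ ρ.re ∧ ρ.re < 1) with hS
  have hmemS : ∀ ρ ∈ S, riemannZeta ρ = 0 ∧ σ₂ ≤ ρ.re ∧ ρ.re ≤ 1 ∧ 0 < ρ.im ∧ ρ.im ≤ T ∧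
      FKS2023.zfrHeight R σ₂ < ρ.im := by
    intro ρ hρ
    rw [hS, Finset.mem_filter, mem_zerosBetween le_rfl] at hρ
    obtain ⟨⟨hz, -, h1, him, hT'⟩, hσ, hlt1⟩ := hρ
    exact ⟨hz, hσ, h1, him, hT',
      FKS2023.zfrHeight_lt_im hRH hR hZFR hσ₂ (lt_of_le_of_lt hσ hlt1) hz him hσ⟩
  have hterm : ∀ ρ ∈ S, (riemannZetaZeroOrder ρ : ℝ) * (x ^ (ρ.re - 1) / ρ.im) ≤
      (riemannZetaZeroOrder ρ : ℝ) * FKS2023.zfrWeight R x (FKS2023.t₀ R σ₂ x) := by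
    intro ρ hρ
    obtain ⟨hz, -, -, him, -, hH⟩ := hmemS ρ hρ
    have hH' : FKS2023.H₀ ≤ ρ.im := (le_max_left _ _).trans hH.le
    have hγ2 : 2 ≤ ρ.im := le_trans (by rw [hH₀]; norm_num) hH'
    have hm : (0 : ℝ) ≤ riemannZetaZeroOrder ρ :=
      Int.cast_nonneg (riemannZetaZeroOrder_nonneg (ne_one_of_riemannZeta_eq_zero hz))
    refine mul_le_mul_of_nonneg_left ?_ hm
    exact (FKS2023.rpow_div_le_zfrWeight hR hZFR hx hz hγ2).trans
      (FKS2023.zfrWeight_le_weight_t₀ hR hx (by linarith) hH.le)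
  have hcount : ∑ ρ ∈ S, (riemannZetaZeroOrder ρ : ℝ) ≤ zetaZeroCountRe σ₂ T :=
    sum_zeroOrder_le_countRe fun ρ hρ ↦
      let ⟨hz, hσ, h1, him, hT', _⟩ := hmemS ρ hρ; ⟨hz, hσ, h1, him, hT'⟩
  have hw0 : 0 ≤ FKS2023.zfrWeight R x (FKS2023.t₀ R σ₂ x) :=
    FKS2023.zfrWeight_nonneg hx0.le (le_trans (by rw [hH₀]; norm_num)
      ((le_max_left _ _).trans (le_max_left _ _)))
  calc 2 * ∑ ρ ∈ S, (riemannZetaZeroOrder ρ : ℝ) * (x ^ (ρ.re - 1) / ρ.im)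
      ≤ 2 * ∑ ρ ∈ S, (riemannZetaZeroOrder ρ : ℝ) * FKS2023.zfrWeight R x (FKS2023.t₀ R σ₂ x) :=
        mul_le_mul_of_nonneg_left (Finset.sum_le_sum hterm) (by norm_num)
    _ = 2 * (∑ ρ ∈ S, (riemannZetaZeroOrder ρ : ℝ)) * FKS2023.zfrWeight R x (FKS2023.t₀ R σ₂ x) := by
        rw [mul_assoc, Finset.sum_mul]
    _ ≤ 2 * zetaZeroCountRe σ₂ T * FKS2023.zfrWeight R x (FKS2023.t₀ R σ₂ x) := by
        gcongr

/-- **FKS Proposition 3.11, Riemann–Stieltjes form** (PROVED): under the numerical-RH fact and a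
zero-free region `σ ≥ 1 − 1/(R log|t|)` (`|t| ≥ 2`, `R > 0`), for `½ < σ₂ ≤ 1`, `x ≥ 1`, and heights
`t₀(σ₂,x) = t_0 ≤ t_1 ≤ … ≤ t_{K−1}` (`K ≥ 1`; printed with `t_K = T`, which the bound does not use),
`Σ_{σ₂}^1(x,T) ≤ 2(Σ_{k=1}^{K−1} N(σ₂,t_k)(w(t_{k−1}) − w(t_k)) + w(t_{K−1}) N(σ₂,T))` for every `T`,
`w(t) = x^{−1/(R log t)}/t`. [cite: FioriKadiriSwidinsky2023, Prop. 3.11] -/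
theorem FioriKadiriSwidinsky2023_prop311 (hRH : platt_trudgian_numerical_rh) {R : ℝ} (hR : 0 < R)
    (hZFR : ∀ σ t : ℝ, 2 ≤ |t| → 1 - 1 / (R * Real.log |t|) ≤ σ → riemannZeta (σ + t * I) ≠ 0)
    {σ₂ : ℝ} (hσ₂ : 1 / 2 < σ₂) {x : ℝ} (hx : 1 ≤ x) {K : ℕ} (hK : 1 ≤ K) {t : ℕ → ℝ}
    (ht0 : t 0 = FKS2023.t₀ R σ₂ x) (hmono : Monotone t) (T : ℝ) :
    FKS2023.zeroSumPsi σ₂ 1 x T ≤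
      2 * (∑ k ∈ Finset.Ico 1 K, (zetaZeroCountRe σ₂ (t k) : ℝ) *
            (FKS2023.zfrWeight R x (t (k - 1)) - FKS2023.zfrWeight R x (t k))
          + FKS2023.zfrWeight R x (t (K - 1)) * zetaZeroCountRe σ₂ T) := by
  classical
  have hx0 : 0 < x := by linarith
  have hH₀ : FKS2023.H₀ = 3 * 10 ^ 12 := rfl
  have htk : ∀ k, FKS2023.t₀ R σ₂ x ≤ t k := fun k ↦ ht0 ▸ hmono (Nat.zero_le k)
  have ht₀0 : 0 ≤ FKS2023.t₀ R σ₂ x :=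
    le_trans (by rw [hH₀]; norm_num) ((le_max_left _ _).trans (le_max_left _ _))
  unfold FKS2023.zeroSumPsi
  refine mul_le_mul_of_nonneg_left ?_ (by norm_num)
  set S := (zerosBetween 0 T).filter (fun ρ ↦ σ₂ ≤ ρ.re ∧ ρ.re < 1) with hS
  set w : ℝ → ℝ := FKS2023.zfrWeight R x with hw
  set m : ℂ → ℝ := fun ρ ↦ (riemannZetaZeroOrder ρ : ℝ) with hm
  have hmemS : ∀ ρ ∈ S, riemannZeta ρ = 0 ∧ σ₂ ≤ ρ.re ∧ ρ.re ≤ 1 ∧ 0 < ρ.im ∧ ρ.im ≤ T ∧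
      FKS2023.zfrHeight R σ₂ < ρ.im := by
    intro ρ hρ
    rw [hS, Finset.mem_filter, mem_zerosBetween le_rfl] at hρ
    obtain ⟨⟨hz, -, h1, him, hT'⟩, hσ, hlt1⟩ := hρ
    exact ⟨hz, hσ, h1, him, hT',
      FKS2023.zfrHeight_lt_im hRH hR hZFR hσ₂ (lt_of_le_of_lt hσ hlt1) hz him hσ⟩
  have hm0 : ∀ ρ ∈ S, 0 ≤ m ρ := fun ρ hρ ↦
    Int.cast_nonneg (riemannZetaZeroOrder_nonneg (ne_one_of_riemannZeta_eq_zero (hmemS ρ hρ).1))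
  -- Step 1: zero by zero, `x^{β−1}/γ ≤ w(γ) ≤` the staircase
  have hterm : ∀ ρ ∈ S, m ρ * (x ^ (ρ.re - 1) / ρ.im) ≤
      (w (t (K - 1)) + ∑ k ∈ Finset.Ico 1 K,
        (if ρ.im ≤ t k then w (t (k - 1)) - w (t k) else 0)) * m ρ := by
    intro ρ hρ
    obtain ⟨hz, -, -, him, -, hH⟩ := hmemS ρ hρ
    have hH' : FKS2023.H₀ ≤ ρ.im := (le_max_left _ _).trans hH.le
    have hγ2 : 2 ≤ ρ.im := le_trans (by rw [hH₀]; norm_num) hH'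
    rw [mul_comm]
    refine mul_le_mul_of_nonneg_right ?_ (hm0 ρ hρ)
    exact (FKS2023.rpow_div_le_zfrWeight hR hZFR hx hz hγ2).trans
      (FKS2023.zfrWeight_le_staircase hR hx (by linarith) hH.le ht0 hmono hK)
  -- Step 2: exchange the sums
  have hexch : ∑ ρ ∈ S, (w (t (K - 1)) + ∑ k ∈ Finset.Ico 1 K,
        (if ρ.im ≤ t k then w (t (k - 1)) - w (t k) else 0)) * m ρ =
      w (t (K - 1)) * ∑ ρ ∈ S, m ρ +
        ∑ k ∈ Finset.Ico 1 K, (w (t (k - 1)) - w (t k)) *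
          ∑ ρ ∈ S.filter (fun ρ ↦ ρ.im ≤ t k), m ρ := by
    have e1 : ∀ ρ ∈ S, (w (t (K - 1)) + ∑ k ∈ Finset.Ico 1 K,
        (if ρ.im ≤ t k then w (t (k - 1)) - w (t k) else 0)) * m ρ =
        w (t (K - 1)) * m ρ +
          ∑ k ∈ Finset.Ico 1 K, (if ρ.im ≤ t k then (w (t (k - 1)) - w (t k)) * m ρ else 0) := by
      intro ρ _
      rw [add_mul, Finset.sum_mul]
      congr 1
      refine Finset.sum_congr rfl fun k _ ↦ ?_
      split_ifs <;> simp
    rw [Finset.sum_congr rfl e1, Finset.sum_add_distrib, ← Finset.mul_sum, Finset.sum_comm]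
    congr 1
    refine Finset.sum_congr rfl fun k _ ↦ ?_
    have e2 : (w (t (k - 1)) - w (t k)) * ∑ ρ ∈ S.filter (fun ρ ↦ ρ.im ≤ t k), m ρ =
        ∑ ρ ∈ S, (if ρ.im ≤ t k then (w (t (k - 1)) - w (t k)) * m ρ else 0) := by
      rw [Finset.sum_filter, Finset.mul_sum]
      refine Finset.sum_congr rfl fun ρ _ ↦ ?_
      split_ifs <;> simp
    rw [e2]
  -- Step 3: the layer counts
  have hcount : ∀ T' : ℝ, ∑ ρ ∈ S.filter (fun ρ ↦ ρ.im ≤ T'), m ρ ≤ zetaZeroCountRe σ₂ T' := by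
    intro T'
    refine sum_zeroOrder_le_countRe fun ρ hρ ↦ ?_
    rw [Finset.mem_filter] at hρ
    obtain ⟨hz, hσ, h1, him, -, -⟩ := hmemS ρ hρ.1
    exact ⟨hz, hσ, h1, him, hρ.2⟩
  have hcountT : ∑ ρ ∈ S, m ρ ≤ zetaZeroCountRe σ₂ T := by
    have e : S.filter (fun ρ ↦ ρ.im ≤ T) = S :=
      Finset.filter_true_of_mem fun ρ hρ ↦ (hmemS ρ hρ).2.2.2.2.1
    simpa [e] using hcount T
  have hcoef : ∀ k, 0 ≤ w (t (k - 1)) - w (t k) := fun k ↦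
    sub_nonneg.2 (FKS2023.zfrWeight_le_of_t₀_le hR hx (htk (k - 1)) (hmono (Nat.sub_le k 1)))
  have hwK : 0 ≤ w (t (K - 1)) := FKS2023.zfrWeight_nonneg hx0.le (ht₀0.trans (htk _))
  calc ∑ ρ ∈ S, m ρ * (x ^ (ρ.re - 1) / ρ.im)
      ≤ ∑ ρ ∈ S, (w (t (K - 1)) + ∑ k ∈ Finset.Ico 1 K,
          (if ρ.im ≤ t k then w (t (k - 1)) - w (t k) else 0)) * m ρ := Finset.sum_le_sum hterm
    _ = w (t (K - 1)) * ∑ ρ ∈ S, m ρ +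
        ∑ k ∈ Finset.Ico 1 K, (w (t (k - 1)) - w (t k)) *
          ∑ ρ ∈ S.filter (fun ρ ↦ ρ.im ≤ t k), m ρ := hexch
    _ ≤ w (t (K - 1)) * zetaZeroCountRe σ₂ T +
        ∑ k ∈ Finset.Ico 1 K, (w (t (k - 1)) - w (t k)) * zetaZeroCountRe σ₂ (t k) := by
        refine add_le_add (mul_le_mul_of_nonneg_left hcountT hwK)
          (Finset.sum_le_sum fun k _ ↦ mul_le_mul_of_nonneg_left (hcount (t k)) (hcoef k))
    _ = ∑ k ∈ Finset.Ico 1 K, (zetaZeroCountRe σ₂ (t k) : ℝ) * (w (t (k - 1)) - w (t k))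
          + w (t (K - 1)) * zetaZeroCountRe σ₂ T := by
        rw [add_comm]
        congr 1
        exact Finset.sum_congr rfl fun k _ ↦ mul_comm _ _

/-! ## Corollary 3.12 -/

/-- `t_0 = t₀`. [cite: FioriKadiriSwidinsky2023, Cor. 3.12] -/
theorem FKS2023.tStep_zero (R σ x T : ℝ) (K : ℕ) : FKS2023.tStep R σ x T K 0 = FKS2023.t₀ R σ x := by
  simp [FKS2023.tStep]

/-- `t₀ > 0` (indeed `t₀ ≥ H₀`). [cite: FioriKadiriSwidinsky2023, Prop. 3.11] -/
theorem FKS2023.H₀_le_t₀ (R σ x : ℝ) : FKS2023.H₀ ≤ FKS2023.t₀ R σ x :=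
  (le_max_left _ _).trans (le_max_left _ _)

/-- `t_K = T` (`K ≥ 1`, `T ≥ 0`). [cite: FioriKadiriSwidinsky2023, Cor. 3.12] -/
theorem FKS2023.tStep_last {R σ x T : ℝ} {K : ℕ} (hK : 1 ≤ K) (hT : 0 ≤ T) :
    FKS2023.tStep R σ x T K K = T := by
  have hH₀ : FKS2023.H₀ = 3 * 10 ^ 12 := rfl
  have ht₀ : 0 < FKS2023.t₀ R σ x := lt_of_lt_of_le (by rw [hH₀]; norm_num) (FKS2023.H₀_le_t₀ R σ x)
  have hK0 : (K : ℝ) ≠ 0 := by exact_mod_cast (by omega : K ≠ 0)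
  unfold FKS2023.tStep
  rw [← Real.rpow_natCast, ← Real.rpow_mul (div_nonneg hT ht₀.le), one_div_mul_cancel hK0,
    Real.rpow_one]
  field_simp

/-- The heights `t_k` increase with `k` (`T ≥ t₀`). [cite: FioriKadiriSwidinsky2023, Cor. 3.12] -/
theorem FKS2023.tStep_mono {R σ x T : ℝ} (K : ℕ) (hT : FKS2023.t₀ R σ x ≤ T) :
    Monotone (FKS2023.tStep R σ x T K) := by
  have hH₀ : FKS2023.H₀ = 3 * 10 ^ 12 := rfl
  have ht₀ : 0 < FKS2023.t₀ R σ x := lt_of_lt_of_le (by rw [hH₀]; norm_num) (FKS2023.H₀_le_t₀ R σ x)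
  have hl : 1 ≤ (T / FKS2023.t₀ R σ x) ^ (1 / (K : ℝ)) :=
    Real.one_le_rpow ((one_le_div ht₀).2 hT) (by positivity)
  intro i j hij
  unfold FKS2023.tStep
  exact mul_le_mul_of_nonneg_left (pow_le_pow_right₀ hl hij) ht₀.le

/-- **FKS Corollary 3.12** (PROVED): under the numerical-RH fact, a zero-free region
`σ ≥ 1 − 1/(R log|t|)` (`|t| ≥ 2`, `R > 0`) and a (ZDB) majorant
`N(σ₂,T') ≤ c₁ T'^p (log T')^q + c₂ log² T'` for `T' ≥ H₀ = 3·10¹²`, for `½ < σ₂ ≤ 1`, `x ≥ 1`,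
`K ≥ 1` and `T ≥ t₀ = max(H_{σ₂}, exp(√(log x/R)))`,
`Σ_{σ₂}^1(x,T) = 2Σ_{0<γ≤T, σ₂≤β<1} m(ρ) x^{β−1}/γ ≤ ε₄(x,σ₂,K,T)`.
[cite: FioriKadiriSwidinsky2023, Cor. 3.12] -/
theorem FioriKadiriSwidinsky2023_cor312 (hRH : platt_trudgian_numerical_rh) {R : ℝ} (hR : 0 < R)
    (hZFR : ∀ σ t : ℝ, 2 ≤ |t| → 1 - 1 / (R * Real.log |t|) ≤ σ → riemannZeta (σ + t * I) ≠ 0)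
    {σ₂ : ℝ} (hσ₂ : 1 / 2 < σ₂) {c₁ c₂ p q : ℝ}
    (hN : ∀ T' : ℝ, FKS2023.H₀ ≤ T' →
      (zetaZeroCountRe σ₂ T' : ℝ) ≤ FKS2023.zdbMajorant c₁ c₂ p q T')
    {K : ℕ} (hK : 1 ≤ K) {x T : ℝ} (hx : 1 ≤ x) (hT : FKS2023.t₀ R σ₂ x ≤ T) :
    FKS2023.zeroSumPsi σ₂ 1 x T ≤ FKS2023.ε₄ c₁ c₂ p q R x σ₂ K T := by
  have hx0 : 0 < x := by linarith
  have hH₀ : FKS2023.H₀ = 3 * 10 ^ 12 := rfl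
  have ht₀H : FKS2023.H₀ ≤ FKS2023.t₀ R σ₂ x := FKS2023.H₀_le_t₀ R σ₂ x
  have ht₀0 : 0 ≤ FKS2023.t₀ R σ₂ x := le_trans (by rw [hH₀]; norm_num) ht₀H
  unfold FKS2023.ε₄
  set t : ℕ → ℝ := FKS2023.tStep R σ₂ x T K with ht
  set w : ℝ → ℝ := FKS2023.zfrWeight R x with hw
  set Nt : ℝ → ℝ := FKS2023.zdbMajorant c₁ c₂ p q with hNt
  have ht0 : t 0 = FKS2023.t₀ R σ₂ x := FKS2023.tStep_zero R σ₂ x T K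
  have hmono : Monotone t := FKS2023.tStep_mono K hT
  have htK : t K = T := FKS2023.tStep_last hK (ht₀0.trans hT)
  have htk : ∀ k, FKS2023.t₀ R σ₂ x ≤ t k := fun k ↦ ht0 ▸ hmono (Nat.zero_le k)
  have h311 := FioriKadiriSwidinsky2023_prop311 hRH hR hZFR hσ₂ hx hK ht0 hmono T
  have hNk : ∀ k, (zetaZeroCountRe σ₂ (t k) : ℝ) ≤ Nt (t k) := fun k ↦ hN _ (ht₀H.trans (htk k))
  have hNT : (zetaZeroCountRe σ₂ T : ℝ) ≤ Nt (t K) := by rw [htK]; exact hN _ (ht₀H.trans hT)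
  have hcoef : ∀ k, 0 ≤ w (t (k - 1)) - w (t k) := fun k ↦
    sub_nonneg.2 (FKS2023.zfrWeight_le_of_t₀_le hR hx (htk (k - 1)) (hmono (Nat.sub_le k 1)))
  have hwK : 0 ≤ w (t (K - 1)) := FKS2023.zfrWeight_nonneg hx0.le (ht₀0.trans (htk _))
  have hmonoform : ∑ k ∈ Finset.Ico 1 K, (zetaZeroCountRe σ₂ (t k) : ℝ) * (w (t (k - 1)) - w (t k))
        + w (t (K - 1)) * zetaZeroCountRe σ₂ T ≤
      ∑ k ∈ Finset.Ico 1 K, Nt (t k) * (w (t (k - 1)) - w (t k)) + w (t (K - 1)) * Nt (t K) :=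
    add_le_add (Finset.sum_le_sum fun k _ ↦ mul_le_mul_of_nonneg_right (hNk k) (hcoef k))
      (mul_le_mul_of_nonneg_left hNT hwK)
  have habel : ∑ k ∈ Finset.Ico 1 K, Nt (t k) * (w (t (k - 1)) - w (t k)) + w (t (K - 1)) * Nt (t K) =
      ∑ k ∈ Finset.Ico 1 K, w (t k) * (Nt (t (k + 1)) - Nt (t k)) + Nt (t 1) * w (t 0) :=
    FKS2023.abel_shift (fun k ↦ Nt (t k)) (fun k ↦ w (t k)) hK
  linarith [h311, hmonoform, habel]

end Literature.NumberTheory.LFunctions
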